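import Mathlib.Analysis.Complex.Trigonometric
import Mathlib.Analysis.SpecialFunctions.Trigonometric.Basic
import Mathlib.RingTheory.RootsOfUnity.Complex
import Mathlib.Tactic.LinearCombination
import HarnessLib

/-!
# Twisted branch contraction: two branches whose quotient has order `3`, twisted by a fifth root of
# unity, contract `ℓ²` by `cos(π/15)`

THEOREM (`twistedBranchContraction`; typed verbatim by the cell qa-qnc0 as
`Sketch32b.TwistedBranchContraction`, ROUND-32 plan γ, item `LogMultiplicityRungFive`).  Let
`σ₀, σ₁` be permutations of a finite set `α` with `(σ₁⁻¹σ₀)³ = 1`, and `ζ ≠ 1` a fifth root of unity in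
`ℂ`.  Then for every `v : α → ℂ`,
`Σ_x ‖v(σ₀ x) + ζ·v(σ₁ x)‖² ≤ (2 + 2cos(2π/15)) · Σ_x ‖v x‖²`, i.e. the branch average
`(P₀ + ζP₁)/2` of the two composition operators has `ℓ²`-norm `≤ cos(π/15)` — "two coprime moduli
(`3` and `5`) in operator clothing".

PROOF (`twistedBranchContraction_of_cube`).  After re-indexing by `σ₁` the operator is `W + ζ` with
`(Wv)(y) = v(ρ y)`, `ρ = σ₀σ₁⁻¹`, `ρ³ = 1`.  Decompose `v = v₀ + v₁ + v₂`,
`v_s = ⅓ Σ_t ω^{−st} W^t v` (`ω = e^{2πi/3}`): `W v_s = ω^s v_s`, the `v_s` are pairwise orthogonal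
(re-index the inner product by the bijection `ρ`), so `‖Wv + ζv‖² = Σ_s |ω^s + ζ|² ‖v_s‖²` and
`‖v‖² = Σ_s ‖v_s‖²`; finally `|ω^s + ζ₅^a|² = 2 + 2cos(2π(5s − 3a)/15) ≤ 2 + 2cos(2π/15)` because
`15 ∤ 5s − 3a` for `a ∈ {1,2,3,4}` (`cos_le_cos_fifteen`).

Printed relative: the scalar two-moduli factor `|1 + e(·/3)e(·/5)|/2 ≤ cos(π/15)` of the exponential
sums of Bourgain and Green–Roy–Straubing [GreenRoyStraubing2005, §2]; the operator form is not located
in print and is SUPPLIED HERE.  No named facts.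
-/

namespace Literature.Probability.MarkovChains.TwistedBranch

open Finset Complex
open scoped ComplexConjugate Real

/-! ### 1. The trigonometric inequality -/

/-- `cos(2πk/15) ≤ cos(2π/15)` for every integer `k` not divisible by `15`. [folklore] -/
private theorem cos_le_cos_fifteen (k : ℤ) (hk : ¬ (15 : ℤ) ∣ k) :
    Real.cos (2 * Real.pi * k / 15) ≤ Real.cos (2 * Real.pi / 15) := by
  -- reduce k modulo 15
  obtain ⟨q, r, hkqr, hr0, hr15⟩ : ∃ q r : ℤ, k = 15 * q + r ∧ 0 ≤ r ∧ r < 15 :=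
    ⟨k / 15, k % 15, by omega, by omega, by omega⟩
  have hr : r ≠ 0 := by
    rintro rfl
    exact hk ⟨q, by rw [hkqr]; ring⟩
  have hper : Real.cos (2 * Real.pi * k / 15) = Real.cos (2 * Real.pi * r / 15) := by
    have : (2 * Real.pi * k / 15 : ℝ) = 2 * Real.pi * r / 15 + q * (2 * Real.pi) := by
      rw [hkqr]; push_cast; ring
    rw [this, Real.cos_add_int_mul_two_pi]
  rw [hper]
  have hpi := Real.pi_pos
  by_cases hr7 : r ≤ 7
  · have hr1 : (1 : ℝ) ≤ r := by exact_mod_cast (show (1 : ℤ) ≤ r by omega)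
    have hr7' : (r : ℝ) ≤ 7 := by exact_mod_cast hr7
    exact Real.cos_le_cos_of_nonneg_of_le_pi (by positivity) (by nlinarith) (by nlinarith)
  · have hr8 : (8 : ℝ) ≤ r := by exact_mod_cast (show (8 : ℤ) ≤ r by omega)
    have hr14 : (r : ℝ) ≤ 14 := by exact_mod_cast (show r ≤ 14 by omega)
    have : Real.cos (2 * Real.pi * r / 15) = Real.cos (2 * Real.pi * (15 - r) / 15) := by
      rw [← Real.cos_two_pi_sub]; congr 1; ring
    rw [this]
    exact Real.cos_le_cos_of_nonneg_of_le_pi (by positivity) (by nlinarith) (by nlinarith)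

/-- `|e^{iθ} + e^{iφ}|² = 2 + 2cos(θ − φ)`. [folklore] -/
private theorem normSq_exp_add_exp (θ φ : ℝ) :
    normSq (exp (θ * I) + exp (φ * I)) = 2 + 2 * Real.cos (θ - φ) := by
  rw [normSq_add]
  have h1 : ∀ x : ℝ, normSq (exp (x * I)) = 1 := fun x => by
    rw [normSq_eq_norm_sq, norm_exp_ofReal_mul_I, one_pow]
  have h2 : exp (θ * I) * conj (exp (φ * I)) = exp ((θ - φ : ℝ) * I) := by
    rw [← exp_conj, map_mul, conj_ofReal, conj_I, ← exp_add]
    congr 1; push_cast; ring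
  rw [h1, h1, h2, exp_ofReal_mul_I_re]
  ring

/-- The twelve constants: `|ω₃^s + ζ₅^a|² ≤ 2 + 2cos(2π/15)` when `15 ∤ 5s − 3a`. [folklore] -/
private theorem normSq_roots_le (s a : ℕ) (h : ¬ (15 : ℤ) ∣ (5 * s - 3 * a : ℤ)) :
    normSq (exp ((2 * Real.pi * s / 3 : ℝ) * I) + exp ((2 * Real.pi * a / 5 : ℝ) * I))
      ≤ 2 + 2 * Real.cos (2 * Real.pi / 15) := by
  rw [normSq_exp_add_exp]
  have : (2 * Real.pi * s / 3 - 2 * Real.pi * a / 5 : ℝ) = 2 * Real.pi * ((5 * s - 3 * a : ℤ) : ℝ) / 15 := by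
    push_cast; ring
  rw [this]
  have := cos_le_cos_fifteen _ h
  linarith

/-! ### 2. The contraction for a cube-root permutation -/

/-- **Twisted branch contraction, permutation form.**  For a map `ρ` with `ρ³ = id` on a finite set,
a fifth root of unity `ζ ≠ 1` and `v : α → ℂ`:
`Σ_y ‖v(ρ y) + ζ v(y)‖² ≤ (2 + 2cos(2π/15)) Σ_y ‖v y‖²`.
[cite: GreenRoyStraubing2005, §2 (the scalar two-moduli factor); operator form supplied here (qa-qnc0 ROUND-32 γ1)] -/
theorem twistedBranchContraction_of_cube {α : Type*} [Fintype α] (ρ : α → α)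
    (hρ : ∀ y, ρ (ρ (ρ y)) = y) {ζ : ℂ} (hζ5 : ζ ^ 5 = 1) (hζ1 : ζ ≠ 1) (v : α → ℂ) :
    ∑ y, ‖v (ρ y) + ζ * v y‖ ^ 2 ≤ (2 + 2 * Real.cos (2 * Real.pi / 15)) * ∑ y, ‖v y‖ ^ 2 := by
  classical
  -- the cube root of unity ω and its algebra
  set ω : ℂ := exp (2 * Real.pi * I / 3) with hωdef
  have hω : IsPrimitiveRoot ω 3 := Complex.isPrimitiveRoot_exp 3 (by norm_num)
  have hω3 : ω ^ 3 = 1 := hω.pow_eq_one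
  have hω1 : ω ≠ 1 := hω.ne_one (by norm_num)
  have hω2 : ω ^ 2 ≠ 1 := hω.pow_ne_one_of_pos_of_lt (by norm_num) (by norm_num)
  have h111 : 1 + ω + ω ^ 2 = 0 := by
    have : (ω - 1) * (1 + ω + ω ^ 2) = 0 := by
      have e : (ω - 1) * (1 + ω + ω ^ 2) = ω ^ 3 - 1 := by ring
      rw [e, hω3, sub_self]
    exact (mul_eq_zero.1 this).resolve_left (sub_ne_zero.2 hω1)
  have hωexp : ∀ s : ℕ, ω ^ s = exp ((2 * Real.pi * s / 3 : ℝ) * I) := by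
    intro s
    rw [hωdef, ← exp_nat_mul]
    congr 1; push_cast; ring
  have hconjω : conj ω = ω ^ 2 := by
    have hn : conj ω * ω = 1 := by
      rw [← normSq_eq_conj_mul_self, normSq_eq_norm_sq]
      have : ω = exp ((2 * Real.pi / 3 : ℝ) * I) := by rw [hωdef]; congr 1; push_cast; ring
      rw [this, norm_exp_ofReal_mul_I]; norm_num
    calc conj ω = conj ω * ω ^ 3 := by rw [hω3, mul_one]
      _ = (conj ω * ω) * ω ^ 2 := by ring
      _ = ω ^ 2 := by rw [hn, one_mul]
  -- ζ = ζ₅^a with a ∈ {1, 2, 3, 4}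
  have hζprim : IsPrimitiveRoot (exp (2 * Real.pi * I / 5)) 5 := Complex.isPrimitiveRoot_exp 5 (by norm_num)
  haveI : NeZero (5 : ℕ) := ⟨by norm_num⟩
  obtain ⟨a, ha5, hζa⟩ := hζprim.eq_pow_of_pow_eq_one hζ5
  have ha0 : a ≠ 0 := by rintro rfl; exact hζ1 (by rw [← hζa, pow_zero])
  have hζexp : ζ = exp ((2 * Real.pi * a / 5 : ℝ) * I) := by
    rw [← hζa, ← exp_nat_mul]; congr 1; push_cast; ring
  -- ρ is a bijection
  have hbij : Function.Bijective ρ :=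
    ⟨fun x y h => by rw [← hρ x, ← hρ y, h], fun y => ⟨ρ (ρ y), hρ y⟩⟩
  -- the three spectral components
  set p : α → ℂ := fun y => (v y + v (ρ y) + v (ρ (ρ y))) / 3 with hp
  set q : α → ℂ := fun y => (v y + ω ^ 2 * v (ρ y) + ω * v (ρ (ρ y))) / 3 with hq
  set r : α → ℂ := fun y => (v y + ω * v (ρ y) + ω ^ 2 * v (ρ (ρ y))) / 3 with hr
  have hsum : ∀ y, v y = 1 * p y + 1 * q y + 1 * r y := by
    intro y; simp only [hp, hq, hr]
    linear_combination (-(v (ρ y) + v (ρ (ρ y))) / 3) * h111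
  have hdec : ∀ y, v (ρ y) + ζ * v y = (1 + ζ) * p y + (ω + ζ) * q y + (ω ^ 2 + ζ) * r y := by
    intro y; simp only [hp, hq, hr]
    linear_combination (-(ζ * (v (ρ y) + v (ρ (ρ y))) + v y + v (ρ (ρ y))) / 3) * h111
      + (-(2 * v (ρ y) + ω * v (ρ (ρ y))) / 3) * hω3
  -- eigen-relations
  have hpρ : ∀ y, p (ρ y) = p y := by
    intro y; simp only [hp]; rw [hρ]; ring
  have hqρ : ∀ y, q (ρ y) = ω * q y := by
    intro y; simp only [hq]; rw [hρ]
    linear_combination (-(v (ρ y))) / 3 * hω3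
  have hrρ : ∀ y, r (ρ y) = ω ^ 2 * r y := by
    intro y; simp only [hr]; rw [hρ]
    linear_combination (-(v (ρ y) + ω * v (ρ (ρ y)))) / 3 * hω3
  -- orthogonality by re-indexing with ρ
  have hpq : ∑ y, p y * conj (q y) = 0 := by
    have e : ∑ y, p y * conj (q y) = ω ^ 2 * ∑ y, p y * conj (q y) := by
      conv_lhs => rw [← hbij.sum_comp (fun y => p y * conj (q y))]
      simp only [hpρ, hqρ, map_mul, hconjω, mul_sum]
      exact sum_congr rfl fun y _ => by ring
    have : (1 - ω ^ 2) * ∑ y, p y * conj (q y) = 0 := by rw [sub_mul, one_mul, ← e, sub_self]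
    exact (mul_eq_zero.1 this).resolve_left (sub_ne_zero.2 (Ne.symm hω2))
  have hpr : ∑ y, p y * conj (r y) = 0 := by
    have e : ∑ y, p y * conj (r y) = ω * ∑ y, p y * conj (r y) := by
      conv_lhs => rw [← hbij.sum_comp (fun y => p y * conj (r y))]
      simp only [hpρ, hrρ, map_mul, map_pow, hconjω, mul_sum]
      refine sum_congr rfl fun y _ => ?_
      have : (ω ^ 2) ^ 2 = ω := by
        calc (ω ^ 2) ^ 2 = ω ^ 3 * ω := by ring
          _ = ω := by rw [hω3, one_mul]
      rw [this]; ring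
    have : (1 - ω) * ∑ y, p y * conj (r y) = 0 := by rw [sub_mul, one_mul, ← e, sub_self]
    exact (mul_eq_zero.1 this).resolve_left (sub_ne_zero.2 (Ne.symm hω1))
  have hqr : ∑ y, q y * conj (r y) = 0 := by
    have e : ∑ y, q y * conj (r y) = ω ^ 2 * ∑ y, q y * conj (r y) := by
      conv_lhs => rw [← hbij.sum_comp (fun y => q y * conj (r y))]
      simp only [hqρ, hrρ, map_mul, map_pow, hconjω, mul_sum]
      refine sum_congr rfl fun y _ => ?_
      have : ω * (ω ^ 2) ^ 2 = ω ^ 2 := by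
        calc ω * (ω ^ 2) ^ 2 = ω ^ 3 * ω ^ 2 := by ring
          _ = ω ^ 2 := by rw [hω3, one_mul]
      linear_combination (q y * conj (r y)) * this
    have : (1 - ω ^ 2) * ∑ y, q y * conj (r y) = 0 := by rw [sub_mul, one_mul, ← e, sub_self]
    exact (mul_eq_zero.1 this).resolve_left (sub_ne_zero.2 (Ne.symm hω2))
  -- Pythagoras for orthogonal triples
  have hexpand : ∀ a b c : ℂ, ∑ y, normSq (a * p y + b * q y + c * r y)
      = normSq a * ∑ y, normSq (p y) + normSq b * ∑ y, normSq (q y)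
        + normSq c * ∑ y, normSq (r y) := by
    intro a b c
    have hpt : ∀ y, normSq (a * p y + b * q y + c * r y)
        = (normSq a * normSq (p y) + normSq b * normSq (q y) + normSq c * normSq (r y))
          + (2 * ((a * conj b) * (p y * conj (q y))).re + 2 * ((a * conj c) * (p y * conj (r y))).re
            + 2 * ((b * conj c) * (q y * conj (r y))).re) := by
      intro y
      have e1 : a * p y * (conj b * conj (q y)) = a * conj b * (p y * conj (q y)) := by ring
      have e2 : a * p y * (conj c * conj (r y)) = a * conj c * (p y * conj (r y)) := by ring
      have e3 : b * q y * (conj c * conj (r y)) = b * conj c * (q y * conj (r y)) := by ring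
      simp only [normSq_add, map_mul, add_mul, Complex.add_re]
      rw [e1, e2, e3]
      ring
    have hre : ∀ (d : ℂ) (X : α → ℂ), ∑ y, X y = 0 → ∑ y, 2 * (d * X y).re = 0 := by
      intro d X hX
      rw [← mul_sum, ← Complex.re_sum, ← mul_sum, hX, mul_zero, Complex.zero_re, mul_zero]
    calc ∑ y, normSq (a * p y + b * q y + c * r y)
        = ∑ y, (normSq a * normSq (p y) + normSq b * normSq (q y) + normSq c * normSq (r y))
          + ∑ y, (2 * ((a * conj b) * (p y * conj (q y))).re
            + 2 * ((a * conj c) * (p y * conj (r y))).re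
            + 2 * ((b * conj c) * (q y * conj (r y))).re) := by
          rw [← sum_add_distrib]; exact sum_congr rfl fun y _ => hpt y
      _ = normSq a * ∑ y, normSq (p y) + normSq b * ∑ y, normSq (q y)
          + normSq c * ∑ y, normSq (r y) + 0 := by
          congr 1
          · rw [sum_add_distrib, sum_add_distrib, mul_sum, mul_sum, mul_sum]
          · rw [sum_add_distrib, sum_add_distrib, hre _ _ hpq, hre _ _ hpr, hre _ _ hqr, add_zero,
              add_zero]
      _ = _ := by rw [add_zero]
  -- the three constants
  have hC0 : normSq (1 + ζ) ≤ 2 + 2 * Real.cos (2 * Real.pi / 15) := by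
    have := normSq_roots_le 0 a (by omega)
    rw [← hωexp 0, pow_zero] at this
    rwa [hζexp]
  have hC1 : normSq (ω + ζ) ≤ 2 + 2 * Real.cos (2 * Real.pi / 15) := by
    have := normSq_roots_le 1 a (by omega)
    rw [← hωexp 1, pow_one] at this
    rwa [hζexp]
  have hC2 : normSq (ω ^ 2 + ζ) ≤ 2 + 2 * Real.cos (2 * Real.pi / 15) := by
    have := normSq_roots_le 2 a (by omega)
    rw [← hωexp 2] at this
    rwa [hζexp]
  -- assemble
  set Np := ∑ y, normSq (p y) with hNp
  set Nq := ∑ y, normSq (q y) with hNq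
  set Nr := ∑ y, normSq (r y) with hNr
  have hL : ∑ y, ‖v (ρ y) + ζ * v y‖ ^ 2
      = normSq (1 + ζ) * Np + normSq (ω + ζ) * Nq + normSq (ω ^ 2 + ζ) * Nr := by
    simp only [Complex.sq_norm, hdec]
    exact hexpand _ _ _
  have hR : ∑ y, ‖v y‖ ^ 2 = Np + Nq + Nr := by
    have h := hexpand 1 1 1
    simp only [map_one, one_mul] at h
    rw [← h]
    simp only [Complex.sq_norm]
    exact sum_congr rfl fun y _ => by rw [← one_mul (p y), ← one_mul (q y), ← one_mul (r y), ← hsum y]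
  have h0p : 0 ≤ Np := sum_nonneg fun y _ => normSq_nonneg _
  have h0q : 0 ≤ Nq := sum_nonneg fun y _ => normSq_nonneg _
  have h0r : 0 ≤ Nr := sum_nonneg fun y _ => normSq_nonneg _
  rw [hL, hR]
  calc normSq (1 + ζ) * Np + normSq (ω + ζ) * Nq + normSq (ω ^ 2 + ζ) * Nr
      ≤ (2 + 2 * Real.cos (2 * Real.pi / 15)) * Np + (2 + 2 * Real.cos (2 * Real.pi / 15)) * Nq
        + (2 + 2 * Real.cos (2 * Real.pi / 15)) * Nr :=
        add_le_add (add_le_add (mul_le_mul_of_nonneg_right hC0 h0p)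
          (mul_le_mul_of_nonneg_right hC1 h0q)) (mul_le_mul_of_nonneg_right hC2 h0r)
    _ = (2 + 2 * Real.cos (2 * Real.pi / 15)) * (Np + Nq + Nr) := by ring

/-! ### 3. The typed statement -/

/-- **Twisted branch contraction (typed `Sketch32b.TwistedBranchContraction` verbatim).**  Two
permutations `σ₀, σ₁` of a finite set with `(σ₁⁻¹σ₀)³ = 1`, twisted by a fifth root of unity `ζ ≠ 1`:
`Σ_x ‖v(σ₀ x) + ζ·v(σ₁ x)‖² ≤ (2 + 2cos(2π/15))·Σ_x ‖v x‖² = 4cos²(π/15)·‖v‖²`.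
[cite: GreenRoyStraubing2005, §2 (the scalar two-moduli factor cos(π/15)); operator form supplied here (qa-qnc0 ROUND-32 γ1)] -/
theorem twistedBranchContraction {α : Type*} [Fintype α] (σ₀ σ₁ : Equiv.Perm α)
    (h3 : ∀ x, σ₁.symm (σ₀ (σ₁.symm (σ₀ (σ₁.symm (σ₀ x))))) = x) (ζ : ℂ) (hζ5 : ζ ^ 5 = 1)
    (hζ1 : ζ ≠ 1) (v : α → ℂ) :
    (∑ x, ‖v (σ₀ x) + ζ * v (σ₁ x)‖ ^ 2) ≤ (2 + 2 * Real.cos (2 * Real.pi / 15)) * ∑ x, ‖v x‖ ^ 2 := by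
  set ρ : α → α := fun y => σ₀ (σ₁.symm y) with hρdef
  have hρ : ∀ y, ρ (ρ (ρ y)) = y := by
    intro y
    have h := congrArg σ₁ (h3 (σ₁.symm y))
    simpa only [hρdef, Equiv.apply_symm_apply] using h
  have hre : ∑ x, ‖v (σ₀ x) + ζ * v (σ₁ x)‖ ^ 2 = ∑ y, ‖v (ρ y) + ζ * v y‖ ^ 2 := by
    rw [← Equiv.sum_comp σ₁.symm (fun x => ‖v (σ₀ x) + ζ * v (σ₁ x)‖ ^ 2)]
    simp only [hρdef, Equiv.apply_symm_apply]
  rw [hre]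
  exact twistedBranchContraction_of_cube ρ hρ hζ5 hζ1 v

end Literature.Probability.MarkovChains.TwistedBranch
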